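import Summits.QuantumFields.QCD.Theses.PauliWegnerSea
import Summits.QuantumFields.QCD.Theorems.PauliWegnerSeaFibreCofactorDominationStubWindow
import Summits.QuantumFields.QCD.Theorems.PauliWegnerSeaFibreCofactorDominationStubCplusOfCrux

/-!
# Crux `FibreCofactorDomination` (stmt-QuantumFields-11510) — the window carries no information

Support file of the lead (line `Sketch-ideator3`, continuation c1).  The crux asks for a window
`θ₀ > 0` bounded only BELOW, and its bound `C₀ (1 + n_w)` is monotone in the in-window count
`n_w = #{charpoly roots of γ₅ D_W(U) with |Re| < θ₀} ≤ 12 L⁴`; at `θ₀ = 11 > ‖γ₅ D_W‖` the count IS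
`12 L⁴ = Fintype.card (TorusSite 4 L × Fin 3 × Fin 4)` (`RandomRefit.stub_window`, p86336).  Hence
the crux is EQUIVALENT to its window-free, volume-weighted form
`∀ m₀ ∈ [-2,2] ∃ C₀ > 0 ∀ L ≥ 4, U, x ≠ y, ∀ W ∃ W' : Σ‖adj_xy(refit W)‖ ≤ C₀ (1 + 12L⁴) ‖det(refit W')‖`
(`fibreCofactorDomination_iff_windowFree`): the statement every line, the disprover
(`Cruxes/FibreCofactorDomination/Disproof.lean`, `VolumeWeighted`) and the negative lemma
`FibreCofactorDomination_false_of_RatioBlowup` actually address.  Recorded here as a kernel-checked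
`↔` so that a planner's restatement can cite it.  Elementary.
-/

noncomputable section

namespace Summit.QuantumFields.QCD.Theorems.RandomRefit

open scoped BigOperators Matrix
open MeasureTheory Filter Literature.MathematicalPhysics.QuantumFieldTheory
  Literature.MathematicalPhysics.QuantumLattice Literature.Probability.LatticeModels

/-- **The crux is equivalent to its window-free form.**  `FibreCofactorDomination` holds iff for
every bare mass `m₀ ∈ [-2,2]` there is `C₀ > 0` such that on every torus `L ≥ 4`, for every
background, every pair `x ≠ y` and every refit `W` of the two stars, some refit `W'` has
`Σ ‖adj_xy(D_W(refit W))‖ ≤ C₀ (1 + card) ‖det D_W(refit W')‖`, `card = 12 L⁴` the number of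
(site, colour, spin) indices.  (`→`: the in-window count is at most `card`; `←`: take `θ₀ = 11`,
where the count equals `card`.) -/
theorem fibreCofactorDomination_iff_windowFree :
    Summit.QuantumFields.QCD.Theses.PauliWegnerSea.FibreCofactorDomination ↔
    ∀ m₀ : ℝ, -2 ≤ m₀ → m₀ ≤ 2 → ∃ C₀ : ℝ, 0 < C₀ ∧ ∀ (L : ℕ) [NeZero L], 4 ≤ L →
      ∀ (U : GaugeConfig 4 L (Matrix.specialUnitaryGroup (Fin 3) ℂ)) (x y : TorusSite 4 L), x ≠ y →
      ∀ W : GaugeConfig 4 L (Matrix.specialUnitaryGroup (Fin 3) ℂ),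
        ∃ W' : GaugeConfig 4 L (Matrix.specialUnitaryGroup (Fin 3) ℂ),
          (∑ a : Fin 3, ∑ i : Fin 4, ∑ b : Fin 3, ∑ j : Fin 4,
            ‖(wilsonDirac (fundamentalRep (Fin 3))
              (fun e => if e.1 = x ∨ Site.shift e.1 e.2 = x ∨ e.1 = y ∨ Site.shift e.1 e.2 = y
                then W e else U e) m₀ 1).adjugate (x, a, i) (y, b, j)‖) ≤
          C₀ * (1 + (Fintype.card (TorusSite 4 L × Fin 3 × Fin 4) : ℝ)) *
            ‖(wilsonDirac (fundamentalRep (Fin 3))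
              (fun e => if e.1 = x ∨ Site.shift e.1 e.2 = x ∨ e.1 = y ∨ Site.shift e.1 e.2 = y
                then W' e else U e) m₀ 1).det‖ := by
  constructor
  · intro hK m₀ hm₁ hm₂
    obtain ⟨θ₀, C₀, _hθ, hC, hmain⟩ := hK m₀ hm₁ hm₂
    refine ⟨C₀, hC, fun L _ hL U x y hxy W => ?_⟩
    have h1 := hmain L hL U x y hxy
    dsimp only at h1
    obtain ⟨W', hW'⟩ := h1 W
    refine ⟨W', hW'.trans ?_⟩
    have hnw := countP_roots_charpoly_le_card (L := L) θ₀ m₀ U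
    gcongr
  · intro hV m₀ hm₁ hm₂
    obtain ⟨C₀, hC, hmain⟩ := hV m₀ hm₁ hm₂
    refine ⟨11, C₀, by norm_num, hC, fun L _ hL U x y hxy => ?_⟩
    dsimp only
    intro W
    obtain ⟨W', hW'⟩ := hmain L hL U x y hxy W
    refine ⟨W', ?_⟩
    have hnw : ((Multiset.countP (fun z : ℂ => |z.re| < 11)
        (spinorLift gammaFive * wilsonDirac (fundamentalRep (Fin 3)) U m₀ 1).charpoly.roots : ℕ) : ℝ)
        = (Fintype.card (TorusSite 4 L × Fin 3 × Fin 4) : ℝ) := by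
      exact_mod_cast stub_window m₀ hm₁ hm₂ L U
    rw [hnw]
    exact hW'

end Summit.QuantumFields.QCD.Theorems.RandomRefit

end
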